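import Mathlib.Algebra.MvPolynomial.Equiv
import Mathlib.Algebra.MvPolynomial.NoZeroDivisors
import Mathlib.Algebra.Polynomial.Roots
import Mathlib.Algebra.BigOperators.Associated
import Mathlib.RingTheory.Polynomial.UniqueFactorization
import Literature.ModelTheory.Zilber.EACDominantProofs
import Literature.NumberTheory.Transcendental.NesterenkoChowFormHypersurface
import HarnessLib

/-!
# Zariski density of exponential points (the Brownawell–Masser trick) and Marker 2006 Cor. 2.4, proved

Two consequences of the tree THEOREM `aslanyanKirbyMantova2023_thm_1_5_holds` (Aslanyan–Kirby–Mantova,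
IMRN 2023, Thm. 1.5 = Brownawell–Masser, JLMS 95 (2017) Prop. 2 for algebraic `V ⊆ ℂⁿ × 𝔾ₘⁿ` of any
dimension with dominant projection to `ℂⁿ`: `V` contains a point `(z̄, exp z̄)`):

1. `exists_mem_inter_expGraph_aeval_ne_zero` / `vanishingIdeal_inter_expGraph` — **the exponential
   points of an irreducible `W ⊆ ℂⁿ × ℂⁿ` whose torus part projects dominantly are Zariski dense in
   `W`** (Aslanyan–Kirby–Mantova Thm. 5.1, last item, p. 18; Brownawell–Masser 2017). The proof is the
   "simple trick" recorded by Mantova–Masser (PLMS 2024, arXiv:2303.05592 p. 5): "if `G` in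
   `ℂ[X₁,…,Xₙ,X̂₁,…,X̂ₙ]` does not vanish on `V`, we may apply [BM2017] to the variety in
   `ℂⁿ⁺¹ × ℂ*ⁿ⁺¹` defined by the equations of `V` together with `G = X̂ₙ₊₁`" — here `liftEqns W G`
   (new free additive coordinate `X₀`, new multiplicative coordinate `Y₀ = G`, old coordinates shifted
   by `Fin.succ`); its torus part projects dominantly (`hasDominantAddProjection_lift`: a relation
   `r(X₀, x) = 0` on it gives, coefficientwise in `X₀`, `x`-polynomials `c` with `c·G ∈ I(W)`, a prime
   not containing `G`), and an exponential point of it restricts to one of `W` with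
   `G = Y₀ = exp X₀ ≠ 0` (`restrict_mem_of_mem_lift`).
2. `inter_expGraph_infinite` (`n ≥ 1`: infinitely many exponential points, `G = ∏ (X₁ - c)` over the
   finitely many first coordinates) and from it **Marker 2006, Corollary 2.4**
   (`marker2006_cor_2_4_holds`, discharging the NAMED FACT `marker2006_cor_2_4` of `EAC.lean`): an
   irreducible `p ∈ ℂ[X, Y]` depending on `X` and on `Y` has infinitely many zeros `(z, eᶻ)` — the
   curve `Z(p)` meets the torus (`p ∤ Y`) and projects dominantly (`p ∤ q(X)` for `q ≠ 0`, by
   `degreeOf`), which is Mantova–Masser's description for `n = 1` (p. 3: "if `dim π(𝒞) = 1`, then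
   `π(Z)` is infinite"). This is NOT Marker's printed proof (Hadamard factorisation + Henson–Rubel);
   it is the Brownawell–Masser route, as the docstring of the fact anticipated.

Honest framing (cell pub-schanuel): bookkeeping for the EAC case ladder — after this file the only
named EAC facts of `EAC.lean` still used as hypotheses are `mantovaMasser2024_thm_1_1` and
`gallinaro2023_thm_8_8` (external published theorems). Nothing here is a new case of
Exponential-Algebraic Closedness, nothing bears on the open cell `ECCell 3 2`, and none of it is
Schanuel's conjecture (EAC ⇏ SC; Aslanyan–Gallinaro 2024 §3.5).

## References
* V. Aslanyan, J. Kirby, V. Mantova, *A geometric approach to some systems of exponential equations*,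
  IMRN 2023 (arXiv:2105.12679), Thm. 1.5 (p. 4), Thm. 5.1 (p. 18).
* W. D. Brownawell, D. W. Masser, *Zero estimates with moving targets*, JLMS 95 (2017) 441–454, Prop. 2.
* V. Mantova, D. Masser, *Polynomial-exponential equations — some new cases of solvability*, PLMS 129
  (2024) e12627 (arXiv:2303.05592), §1 (p. 3, the case `n = 1`; p. 5, the density trick).
* D. Marker, *A remark on Zilber's pseudoexponentiation*, J. Symb. Logic 71 (2006) 791–798, Cor. 2.4.
-/

noncomputable section

open MvPolynomial

namespace Literature.ModelTheory.Zilber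

open Literature.NumberTheory.Transcendental

variable {n : ℕ}

/-! ### A small fact on `degreeOf` (the companion `degreeOf_rename_of_not_mem_range` is the tree's, `NesterenkoChowFormHypersurface.lean`) -/

/-- Over a domain, a divisor of a non-zero polynomial not involving the variable `i` does not involve
`i` (`degreeOf_mul_eq`). [folklore] -/
theorem degreeOf_eq_zero_of_dvd {σ R : Type*} [CommRing R] [IsDomain R] {i : σ}
    {p f : MvPolynomial σ R} (hpf : p ∣ f) (hf : f ≠ 0) (hfi : f.degreeOf i = 0) :
    p.degreeOf i = 0 := by
  obtain ⟨q, rfl⟩ := hpf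
  rw [degreeOf_mul_eq (left_ne_zero_of_mul hf) (right_ne_zero_of_mul hf)] at hfi
  omega

/-- `X i - C c ≠ 0` (evaluate at `c + 1`). [folklore] -/
theorem X_sub_C_ne_zero {σ : Type*} (i : σ) (c : ℂ) : (X i - C c : MvPolynomial σ ℂ) ≠ 0 := by
  intro h
  have := congrArg (eval fun _ => c + 1) h
  simp at this

/-! ### The lift `V⁺ ⊆ ℂⁿ⁺¹ × (ℂˣ)ⁿ⁺¹`: one more coordinate turns `G ≠ 0` into the equation `Y₀ = G` -/

/-- The equations of the lifted variety of the Brownawell–Masser trick (Mantova–Masser 2024, p. 5: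
"the variety in `ℂⁿ⁺¹ × ℂ*ⁿ⁺¹` defined by the equations of `V` together with `G = X̂ₙ₊₁`"): the
coordinates of `ℂⁿ × ℂⁿ` are shifted by `Fin.succ`, the new additive coordinate `X₀` is free, and the
new multiplicative coordinate satisfies `Y₀ = G`; the equations of `W` are those of its vanishing
ideal. [cite: MantovaMasser2023, §1 (p. 5)] -/
def liftEqns (W : Set (Fin n ⊕ Fin n → ℂ)) (G : MvPolynomial (Fin n ⊕ Fin n) ℂ) :
    Set (MvPolynomial (Fin (n + 1) ⊕ Fin (n + 1)) ℂ) :=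
  insert (X (Sum.inr 0) - rename (Sum.map Fin.succ Fin.succ) G)
    (rename (Sum.map Fin.succ Fin.succ) ''
      (vanishingIdeal ℂ W : Set (MvPolynomial (Fin n ⊕ Fin n) ℂ)))

/-- The point `(y, x ; v, w) ∈ ℂⁿ⁺¹ × ℂⁿ⁺¹` over `z = (x ; w) ∈ ℂⁿ × ℂⁿ` with new coordinates
`X₀ = y`, `Y₀ = v`. [folklore] -/
def liftPt (z : Fin n ⊕ Fin n → ℂ) (y v : ℂ) : Fin (n + 1) ⊕ Fin (n + 1) → ℂ :=
  Sum.elim (Fin.cons y fun j => z (Sum.inl j)) (Fin.cons v fun j => z (Sum.inr j))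

/-- New additive coordinate of the lifted point. [folklore] -/
@[simp] theorem liftPt_inl_zero (z : Fin n ⊕ Fin n → ℂ) (y v : ℂ) :
    liftPt z y v (Sum.inl 0) = y := by
  simp [liftPt]

/-- New multiplicative coordinate of the lifted point. [folklore] -/
@[simp] theorem liftPt_inr_zero (z : Fin n ⊕ Fin n → ℂ) (y v : ℂ) :
    liftPt z y v (Sum.inr 0) = v := by
  simp [liftPt]

/-- Old additive coordinates of the lifted point. [folklore] -/
@[simp] theorem liftPt_inl_succ (z : Fin n ⊕ Fin n → ℂ) (y v : ℂ) (j : Fin n) :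
    liftPt z y v (Sum.inl j.succ) = z (Sum.inl j) := by
  simp [liftPt]

/-- Old multiplicative coordinates of the lifted point. [folklore] -/
@[simp] theorem liftPt_inr_succ (z : Fin n ⊕ Fin n → ℂ) (y v : ℂ) (j : Fin n) :
    liftPt z y v (Sum.inr j.succ) = z (Sum.inr j) := by
  simp [liftPt]

/-- Restricting the lifted point along the coordinate shift recovers `z`. [folklore] -/
theorem liftPt_comp (z : Fin n ⊕ Fin n → ℂ) (y v : ℂ) :
    liftPt z y v ∘ Sum.map Fin.succ Fin.succ = z := by
  funext s
  rcases s with j | j <;> simp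

/-- The additive projection of the lifted point is `(y, π z)`. [folklore] -/
theorem projAdd_liftPt (z : Fin n ⊕ Fin n → ℂ) (y v : ℂ) :
    projAdd (liftPt z y v) = Fin.cons y (projAdd z) := by
  funext i
  refine Fin.cases ?_ (fun j => ?_) i
  · simp
  · simp

/-- Over a point `z ∈ W`, the point `(y, x ; G(z), w)` lies on the lifted variety, for every `y`.
[folklore] -/
theorem liftPt_mem_zeroLocus {W : Set (Fin n ⊕ Fin n → ℂ)} (G : MvPolynomial (Fin n ⊕ Fin n) ℂ)
    {z : Fin n ⊕ Fin n → ℂ} (hz : z ∈ W) (y : ℂ) :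
    liftPt z y (aeval z G) ∈ zeroLocus ℂ (Ideal.span (liftEqns W G)) := by
  rw [zeroLocus_span, Set.mem_setOf_eq]
  unfold liftEqns
  rintro q (rfl | ⟨q₀, hq₀, rfl⟩)
  · rw [map_sub, aeval_X, aeval_rename, liftPt_comp, liftPt_inr_zero, sub_self]
  · rw [aeval_rename, liftPt_comp]
    exact (mem_vanishingIdeal_iff.mp (SetLike.mem_coe.mp hq₀)) z hz

/-- Over a torus point `z` with `G(z) ≠ 0`, the lifted point is a torus point. [folklore] -/
theorem liftPt_mem_torusLocus {G : MvPolynomial (Fin n ⊕ Fin n) ℂ} {z : Fin n ⊕ Fin n → ℂ}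
    (hzT : z ∈ torusLocus ℂ n) (hGz : aeval z G ≠ 0) (y : ℂ) :
    liftPt z y (aeval z G) ∈ torusLocus ℂ (n + 1) := by
  rw [mem_torusLocus_iff]
  intro i
  refine Fin.cases ?_ (fun j => ?_) i
  · rw [liftPt_inr_zero]
    exact hGz
  · rw [liftPt_inr_succ]
    exact (mem_torusLocus_iff.mp hzT) j

/-- **Dominance of the lift.** If `W` is irreducible, `V = W ∩ (ℂⁿ × (ℂˣ)ⁿ)` projects dominantly to
`ℂⁿ` and `G ∉ I(W)`, then the torus part of the lifted variety projects dominantly to `ℂⁿ⁺¹`: if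
`r(X₀, x)` vanishes on it, then for each `z ∈ V` with `G(z) ≠ 0` the one-variable polynomial
`r(·, π z)` vanishes identically, so every coefficient `c(x)` of `r` in `X₀` satisfies `c·G ∈ I(V) =
I(W)`; as `I(W)` is prime and `G ∉ I(W)`, `c` vanishes on `π(V)`, hence `c = 0`.
[cite: MantovaMasser2023, §1 (p. 5)] -/
theorem hasDominantAddProjection_lift {W : Set (Fin n ⊕ Fin n → ℂ)} (hW : IsIrreducibleClosed ℂ W)
    (hdom : HasDominantAddProjection ℂ (W ∩ torusLocus ℂ n)) {G : MvPolynomial (Fin n ⊕ Fin n) ℂ}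
    (hG : G ∉ vanishingIdeal ℂ W) :
    HasDominantAddProjection ℂ (zeroLocus ℂ (Ideal.span (liftEqns W G)) ∩ torusLocus ℂ (n + 1)) := by
  classical
  have hIWT : vanishingIdeal ℂ (W ∩ torusLocus ℂ n) = vanishingIdeal ℂ W :=
    vanishingIdeal_inter_torusLocus hW hdom.nonempty
  intro r hr
  -- every coefficient of `r`, viewed as a polynomial in the new variable `X₀`, vanishes
  suffices hQ : finSuccEquiv ℂ n r = 0 by
    exact (finSuccEquiv ℂ n).injective (by rw [hQ, map_zero])
  refine Polynomial.ext fun k => ?_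
  rw [Polynomial.coeff_zero]
  -- `c_k · G` vanishes on `V = W ∩ (ℂⁿ × (ℂˣ)ⁿ)`
  have hck : rename Sum.inl ((finSuccEquiv ℂ n r).coeff k) * G ∈
      vanishingIdeal ℂ (W ∩ torusLocus ℂ n) := by
    rw [mem_vanishingIdeal_iff]
    rintro z ⟨hzW, hzT⟩
    rw [map_mul, aeval_rename]
    by_cases hGz : aeval z G = 0
    · rw [hGz, mul_zero]
    · have hvan : ∀ y : ℂ,
          Polynomial.eval y (Polynomial.map (eval (projAdd z)) (finSuccEquiv ℂ n r)) = 0 := by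
        intro y
        have h := hr _ ⟨liftPt_mem_zeroLocus G hzW y, liftPt_mem_torusLocus hzT hGz y⟩
        rw [projAdd_liftPt, eval_eq_eval_mv_eval'] at h
        exact h
      have hmap : Polynomial.map (eval (projAdd z)) (finSuccEquiv ℂ n r) = 0 :=
        Polynomial.funext fun y => by rw [Polynomial.eval_zero]; exact hvan y
      have hk : eval (projAdd z) ((finSuccEquiv ℂ n r).coeff k) = 0 := by
        rw [← Polynomial.coeff_map, hmap, Polynomial.coeff_zero]
      have h3 : aeval (z ∘ Sum.inl) ((finSuccEquiv ℂ n r).coeff k) =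
          eval (projAdd z) ((finSuccEquiv ℂ n r).coeff k) := rfl
      rw [h3, hk, zero_mul]
  rw [hIWT] at hck
  have h2 := (hW.2.mem_or_mem hck).resolve_right hG
  rw [← hIWT, ← mem_vanishingIdeal_image_projAdd_iff,
    (hasDominantAddProjection_iff_vanishingIdeal_eq_bot _).mp hdom, Ideal.mem_bot] at h2
  exact h2

/-- **Restriction.** An exponential point of the lifted variety restricts, along the coordinate shift,
to an exponential point of `W` at which `G = Y₀ = exp X₀ ≠ 0`. [cite: MantovaMasser2023, §1 (p. 5)] -/
theorem restrict_mem_of_mem_lift {W : Set (Fin n ⊕ Fin n → ℂ)} (hW : IsZariskiClosed ℂ W)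
    {G : MvPolynomial (Fin n ⊕ Fin n) ℂ} {z' : Fin (n + 1) ⊕ Fin (n + 1) → ℂ}
    (hz' : z' ∈ zeroLocus ℂ (Ideal.span (liftEqns W G)) ∩ expGraph ℂ (n + 1)) :
    z' ∘ Sum.map Fin.succ Fin.succ ∈ W ∩ expGraph ℂ n ∧
      aeval (z' ∘ Sum.map Fin.succ Fin.succ) G ≠ 0 := by
  obtain ⟨hz'W, hz'E⟩ := hz'
  rw [zeroLocus_span, Set.mem_setOf_eq] at hz'W
  unfold liftEqns at hz'W
  refine ⟨⟨?_, ?_⟩, ?_⟩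
  · rw [eq_zeroLocus_vanishingIdeal_of_isZariskiClosed hW, mem_zeroLocus_iff]
    intro q hq
    have h := hz'W (rename (Sum.map Fin.succ Fin.succ) q) (Set.mem_insert_of_mem _ ⟨q, hq, rfl⟩)
    rwa [aeval_rename] at h
  · rw [mem_expGraph_iff] at hz'E ⊢
    intro j
    exact hz'E (Fin.succ j)
  · have h := hz'W _ (Set.mem_insert _ _)
    rw [map_sub, aeval_X, aeval_rename, sub_eq_zero] at h
    rw [← h]
    exact (mem_torusLocus_iff.mp (expGraph_subset_torusLocus hz'E)) 0

/-! ### Zariski density of the exponential points -/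

/-- **Brownawell–Masser's density trick (Mantova–Masser 2024, p. 5; Aslanyan–Kirby–Mantova 2023,
Thm. 5.1).** Let `W ⊆ ℂⁿ × ℂⁿ` be irreducible Zariski closed with `V = W ∩ (ℂⁿ × (ℂˣ)ⁿ)` projecting
dominantly to `ℂⁿ`, and let `G` be a polynomial not vanishing identically on `W`. Then some point
`(z, exp z) ∈ W` has `G(z, exp z) ≠ 0`. Proof: apply `aslanyanKirbyMantova2023_thm_1_5_holds` in
dimension `n + 1` to the lifted variety `liftEqns W G` (`hasDominantAddProjection_lift`) and restrict
(`restrict_mem_of_mem_lift`). Irreducibility of `W` cannot be dropped (a non-dominant component may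
carry the open set `G ≠ 0`). [cite: MantovaMasser2023, §1 (p. 5)] -/
theorem exists_mem_inter_expGraph_aeval_ne_zero {W : Set (Fin n ⊕ Fin n → ℂ)}
    (hW : IsIrreducibleClosed ℂ W) (hdom : HasDominantAddProjection ℂ (W ∩ torusLocus ℂ n))
    {G : MvPolynomial (Fin n ⊕ Fin n) ℂ} (hG : G ∉ vanishingIdeal ℂ W) :
    ∃ z ∈ W ∩ expGraph ℂ n, aeval z G ≠ 0 := by
  obtain ⟨z', hz'⟩ := aslanyanKirbyMantova2023_thm_1_5_holds (n + 1)
    (zeroLocus ℂ (Ideal.span (liftEqns W G))) (isZariskiClosed_zeroLocus _)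
    (hasDominantAddProjection_lift hW hdom hG)
  obtain ⟨hmem, hne⟩ := restrict_mem_of_mem_lift hW.1 hz'
  exact ⟨_, hmem, hne⟩

/-- **The exponential points are Zariski dense** (Aslanyan–Kirby–Mantova 2023, Thm. 5.1, last item,
p. 18: "the set of exponential points `{(z̄, exp z̄) ∈ V}` is Zariski dense in `V`"; Brownawell–Masser
2017): for `W` irreducible with dominantly projecting torus part, `I(W ∩ expGraph) = I(W)`.
[cite: AslanyanKirbyMantova2021, Thm. 5.1 (p. 18)] -/
theorem vanishingIdeal_inter_expGraph {W : Set (Fin n ⊕ Fin n → ℂ)} (hW : IsIrreducibleClosed ℂ W)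
    (hdom : HasDominantAddProjection ℂ (W ∩ torusLocus ℂ n)) :
    vanishingIdeal ℂ (W ∩ expGraph ℂ n) = vanishingIdeal ℂ W := by
  refine le_antisymm (fun G hG => ?_) (vanishingIdeal_anti_mono Set.inter_subset_left)
  by_contra hGW
  obtain ⟨z, hz, hne⟩ := exists_mem_inter_expGraph_aeval_ne_zero hW hdom hGW
  exact hne ((mem_vanishingIdeal_iff.mp hG) z hz)

/-- Consequently the exponential points of `W` have the full Zariski dimension of `W`.
[cite: AslanyanKirbyMantova2021, Thm. 5.1 (p. 18)] -/
theorem zariskiDim_inter_expGraph {W : Set (Fin n ⊕ Fin n → ℂ)} (hW : IsIrreducibleClosed ℂ W)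
    (hdom : HasDominantAddProjection ℂ (W ∩ torusLocus ℂ n)) :
    zariskiDim ℂ (W ∩ expGraph ℂ n) = zariskiDim ℂ W := by
  unfold zariskiDim
  rw [vanishingIdeal_inter_expGraph hW hdom]

/-- **Infinitely many exponential points.** For `n ≥ 1`, an irreducible `W ⊆ ℂⁿ × ℂⁿ` whose torus part
projects dominantly to `ℂⁿ` contains infinitely many points `(z, exp z)`: were they finitely many,
with first coordinates in a finite set `T`, the `x`-polynomial `g = ∏_{c ∈ T} (X₁ - c) ≠ 0` would not
vanish identically on `V` (dominance), so some exponential point of `W` would have `g ≠ 0`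
(`exists_mem_inter_expGraph_aeval_ne_zero`), i.e. first coordinate outside `T`. Mantova–Masser 2024
p. 3: "the set of all such projections is not only infinite but even Zariski dense".
[cite: MantovaMasser2023, §1 (p. 3)] -/
theorem inter_expGraph_infinite (hn : 0 < n) {W : Set (Fin n ⊕ Fin n → ℂ)}
    (hW : IsIrreducibleClosed ℂ W) (hdom : HasDominantAddProjection ℂ (W ∩ torusLocus ℂ n)) :
    (W ∩ expGraph ℂ n).Infinite := by
  classical
  by_contra hfin
  rw [Set.not_infinite] at hfin
  set i₀ : Fin n := ⟨0, hn⟩ with hi₀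
  set T : Finset ℂ := (hfin.image fun z => z (Sum.inl i₀)).toFinset with hT
  set g : MvPolynomial (Fin n) ℂ := ∏ c ∈ T, (X i₀ - C c) with hg
  have hg0 : g ≠ 0 := Finset.prod_ne_zero_iff.mpr fun c _ => X_sub_C_ne_zero _ _
  have hGI : rename Sum.inl g ∉ vanishingIdeal ℂ W := by
    intro hmem
    apply hg0
    refine hdom g fun z hz => ?_
    have h := (mem_vanishingIdeal_iff.mp hmem) z hz.1
    rw [aeval_rename] at h
    exact h
  obtain ⟨z, hz, hGz⟩ := exists_mem_inter_expGraph_aeval_ne_zero hW hdom hGI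
  apply hGz
  rw [aeval_rename, hg, map_prod]
  refine Finset.prod_eq_zero (i := z (Sum.inl i₀)) ?_ (by simp)
  rw [hT, Set.Finite.mem_toFinset]
  exact ⟨z, hz, rfl⟩

/-! ### Marker 2006, Corollary 2.4 -/

/-- **Marker 2006, Corollary 2.4, proved** (J. Symb. Logic 71, p. 795): if `p ∈ ℂ[X, Y]` is irreducible
and depends on `X` and on `Y`, then `p(z, eᶻ)` has infinitely many zeros. The curve `W = Z(p)` is
irreducible (`(p)` is prime, `I(Z(p)) = (p)`); it meets the torus `Y ≠ 0` (else `p ∣ Y`, so `p` would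
not involve `X`); its torus part projects dominantly to `ℂ` (a non-zero `q(X)` vanishing on it gives
`p ∣ q(X)`, so `p` would not involve `Y`); hence `inter_expGraph_infinite` applies. This is the
Brownawell–Masser route (Mantova–Masser 2024 p. 3, `n = 1`: "if `dim π(𝒞) = 1`, then `π(Z)` is
infinite"), not Marker's Hadamard-factorisation proof; it discharges the named fact
`marker2006_cor_2_4` of `EAC.lean`. [cite: Marker2006Remark, Cor. 2.4] -/
theorem marker2006_cor_2_4_holds : marker2006_cor_2_4 := by
  classical
  intro p hp hX hY
  -- the prime ideal `(p)` and the irreducible curve `W = Z(p)`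
  haveI hprime : (Ideal.span {p} : Ideal (MvPolynomial (Fin 1 ⊕ Fin 1) ℂ)).IsPrime :=
    (Ideal.span_singleton_prime hp.ne_zero).mpr
      (UniqueFactorizationMonoid.irreducible_iff_prime.mp hp)
  have hIW : vanishingIdeal ℂ (zeroLocus ℂ (Ideal.span {p}) : Set (Fin 1 ⊕ Fin 1 → ℂ)) =
      Ideal.span {p} :=
    MvPolynomial.IsPrime.vanishingIdeal_zeroLocus (K := ℂ) _
  have hW : IsIrreducibleClosed ℂ (zeroLocus ℂ (Ideal.span {p}) : Set (Fin 1 ⊕ Fin 1 → ℂ)) :=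
    isIrreducibleClosed_zeroLocus _
  -- `p` divides no non-zero polynomial free of `X`, and none free of `Y`
  have hndvd : ∀ f : MvPolynomial (Fin 1 ⊕ Fin 1) ℂ, f ≠ 0 →
      (f.degreeOf (Sum.inl 0) = 0 ∨ f.degreeOf (Sum.inr 0) = 0) → f ∉ Ideal.span {p} := by
    intro f hf hdeg hmem
    rw [Ideal.mem_span_singleton] at hmem
    rcases hdeg with h | h
    · exact absurd (degreeOf_eq_zero_of_dvd hmem hf h) hX.ne'
    · exact absurd (degreeOf_eq_zero_of_dvd hmem hf h) hY.ne'
  -- `W` meets the torus `Y ≠ 0`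
  have hYnot : ∀ i, (X (Sum.inr i) : MvPolynomial (Fin 1 ⊕ Fin 1) ℂ) ∉ Ideal.span {p} := by
    intro i
    refine hndvd _ (X_ne_zero _) (Or.inl ?_)
    rw [degreeOf_X, if_neg Sum.inl_ne_inr]
  have hne : (zeroLocus ℂ (Ideal.span {p}) ∩ torusLocus ℂ 1).Nonempty :=
    zeroLocus_inter_torusLocus_nonempty_of_X_inr_notMem _ hYnot
  -- the torus part of `W` projects dominantly to `ℂ`
  have hdom : HasDominantAddProjection ℂ (zeroLocus ℂ (Ideal.span {p}) ∩ torusLocus ℂ 1) := by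
    intro q hq
    by_contra hq0
    have hmem : rename Sum.inl q ∈ vanishingIdeal ℂ (zeroLocus ℂ (Ideal.span {p}) ∩ torusLocus ℂ 1) := by
      rw [mem_vanishingIdeal_iff]
      intro z hz
      rw [aeval_rename]
      exact hq z hz
    rw [vanishingIdeal_inter_torusLocus hW hne, hIW] at hmem
    have hne0 : (rename Sum.inl q : MvPolynomial (Fin 1 ⊕ Fin 1) ℂ) ≠ 0 := fun h =>
      hq0 (rename_injective (Sum.inl : Fin 1 → Fin 1 ⊕ Fin 1) Sum.inl_injective
        (by rw [h, map_zero]))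
    refine hndvd _ hne0 (Or.inr (Nesterenko.degreeOf_rename_of_not_mem_range Sum.inl q ?_)) hmem
    rintro ⟨i, hi⟩
    exact Sum.inl_ne_inr hi
  exact inter_expGraph_infinite Nat.one_pos hW hdom

end Literature.ModelTheory.Zilber
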